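import Summits.QuantumFields.BalabanUV.Beta.EriceFlowEnclosureB12AsPrintedHistoryContagionShiftFlowZeroSemigroupGellMannLowExact
import Summits.QuantumFields.BalabanUV.Beta.EriceFlowEnclosureB12AsPrintedHistoryContagionShiftFlowZeroSemigroupCanonical

/-!
# Beta / EriceFlowEnclosureB12AsPrintedHistoryContagionShiftFlowZeroSemigroupGenerator — ASYMPTOTIC FREEDOM IS CONTAGIOUS, part 64: THE ALMOST-EVERYWHERE GENERATOR IS A
# COMPLETE INVARIANT OF THE CONTINUOUS RENORMALIZATION GROUP, AND ONE-LOOP RIGIDITY.  Parts 55–59 produced the generator `β_c = β₀∕Λ′` only almost everywhere; nothing is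
# lost: (§103, ABSTRACT) `β_c` is a MEASURABLE function (`generator_measurable`, Mathlib's `measurable_deriv`); two Λ-coordinates with part 35's chart bounds whose
# derivatives agree ALMOST EVERYWHERE differ by a constant on ]0, e′] (**`abel_sub_eq_of_deriv_ae_eq`** — both are absolutely continuous (part 59) and Mathlib's
# `AbsolutelyContinuousOnInterval.const_of_ae_hasDerivAt_zero`), hence generate THE SAME continuous renormalization group (**`rg_eq_of_deriv_ae_eq`**, part 47's
# `rg_eq_of_sub_eq`): the a.e. velocity field DETERMINES the group — «group ⟹ generator a.e.» (part 56) and «generator a.e. ⟹ group» (here).  ONE-LOOP RIGIDITY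
# (**`oneLoop_rigidity`**): if the generator is the one-loop field almost everywhere — `Λ′(x) = −2∕x³` for a.e. `x ∈ ]0, e′[` — then `Λ g − Λ e′ = 1∕g² − 1∕e′²` EXACTLY
# and the continuous RG IS the textbook one-loop running coupling **`φ_s g = 1∕√(1∕g² + sβ₀)`** (`rg_eq_oneLoop_closedForm`, part 52's toy); FOR THE FLOW (any dynamical Abel
# function, part 14's package): then along every trajectory `1∕h(k)² = 1∕e² + kβ₀` and **the memory functional equals β₀ on every ultraviolet tail of every trajectory near
# the zero pin** (**`functional_const_of_oneLoop_generator`**) — an a.e.-one-loop generator forces a trivial functional on the flow's own histories; and (§104) the a.e.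
# ENVELOPE of the generator: **`−(β₀∕2)x³∕(1 − κx) ≤ β₀∕Λ′(x) ≤ −(β₀∕2)x³∕(1 + κx)`** for a.e. `x ∈ ]0, e′[` (`generator_ae_envelope`, from part 57) — β_c is an
# `L^∞_loc` function squeezed between two explicit one-loop envelopes.
# (β-flow team, prover 1 = recursion ∕ upper ∕ bare-coupling ∕ uniqueness side, unit `b2b-balaban-beta-bflow-p1`, gen 41; ROW AP-I·Uc × NODE U2 — the infinitesimal
# renormalization group, invariance ∕ rigidity; over parts 55 ∕ 57 ∕ 59 ∕ 61 (`ae_differentiableAt_abel`, `ae_hasDerivAt_dynAbel_oneLoop`, `abel_absolutelyContinuousOnInterval`,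
# `const_hasDerivAt`, `const_chart_bounds`), part 52 (`const_strictAntiOn`, `const_onto`, `const_rg_eq`), part 47 (`rg_eq_of_sub_eq`), part 46 (`rg_mem_eq`, `rg_natCast_eq`),
# part 44 (`dynAbel_shift`), part 13, part 34)

HONEST FRAMING (page 1 of everything the β sub-cell writes): discharging `BetaPertH` makes Bałaban's UV stability UNCONDITIONAL — a
real constructive-QFT result; it is NOT the continuum limit and NOT the Clay problem.  HONEST DEPENDENCY (cell reorg 2026-08-19,
verbatim): «continuum YM on T⁴ ⇐ BetaPertH ∧ nine spine estimates (0/9 proved); BetaPertH ⇐ (D1) ∧ (D4) ∧ CAP+tail; G-an2-4 gates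
asym, D1 and NE2/3/4.»  THIS MODULE DISCHARGES NOTHING: [folklore] real analysis (measurability of `deriv`, absolutely continuous functions with a.e. zero derivative are
constant — Mathlib) over node U2's HYPOTHESIS SHAPES on an ABSTRACT functional `B`; parts 13 ∕ 34 ∕ 44 ∕ 46 ∕ 47 ∕ 52 ∕ 55 ∕ 57 ∕ 59 ∕ 61 BY NAME — nothing restated.
[I] THEOREM 2 does not occur in this abstract part; NOTHING is asserted about Bałaban's actual β (in particular NOT that its generator is or is not one-loop a.e.); «generator»,
«β_c», «one-loop rigidity» are OUR READING.  [I] = T. Bałaban, Commun. Math. Phys. **109** (1987) 249–301 [Balaban1987RG1]: Thm 2 (0.31) p. 259 — context of the row only.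

WHAT THIS FILE PROVES (0 sorry, 0 def): §103 `generator_measurable`, `strictAntiOn_of_bounds`, **`abel_sub_eq_of_deriv_ae_eq`**, **`rg_eq_of_deriv_ae_eq`**,
**`oneLoop_rigidity`**, **`rg_eq_oneLoop_closedForm`**, **`functional_const_of_oneLoop_generator`**; §104 **`generator_ae_envelope`**.  NOT CLAIMED: anything about
Bałaban's β; `BetaPertH`; continuum; Clay.
-/

namespace Summit.QuantumFields.BalabanUV.Beta.EriceFlowEnclosureB12AsPrintedHistoryContagionShiftFlowZeroSemigroupGenerator

open Filter Topology Set Function MeasureTheory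
open Literature.MathematicalPhysics.QuantumFieldTheory.Balaban1983to89
open Literature.MathematicalPhysics.QuantumFieldTheory.Balaban1983to89.T4BetaStationary (SeqBox MemoryProfile)
open Literature.MathematicalPhysics.QuantumFieldTheory.Balaban1983to89.T4BetaFlowWellPosed (MemFlow solution one_div_sq_one_div_sqrt)
open Summit.QuantumFields.BalabanUV.Beta.EriceFlowEnclosureB12AsPrintedHistoryContagionShiftFlowPicardLimit (memFlow_solution_of_reference)
open Summit.QuantumFields.BalabanUV.Beta.EriceFlowEnclosureB12AsPrintedHistoryContagionShiftFlowZeroOffset (package_of_le succ_le_of_reference_flow)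
open Summit.QuantumFields.BalabanUV.Beta.EriceFlowEnclosureB12AsPrintedHistoryContagionShiftFlowZeroIsometry (dynAbel_shift)
open Summit.QuantumFields.BalabanUV.Beta.EriceFlowEnclosureB12AsPrintedHistoryContagionShiftFlowZeroSemigroup (rg_mem_eq rg_natCast_eq)
open Summit.QuantumFields.BalabanUV.Beta.EriceFlowEnclosureB12AsPrintedHistoryContagionShiftFlowZeroSemigroupCanonical (rg_eq_of_sub_eq)
open Summit.QuantumFields.BalabanUV.Beta.EriceFlowEnclosureB12AsPrintedHistoryContagionShiftFlowZeroSemigroupExact (const_strictAntiOn const_onto const_rg_eq)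
open Summit.QuantumFields.BalabanUV.Beta.EriceFlowEnclosureB12AsPrintedHistoryContagionShiftFlowZeroSemigroupVelocity (ae_differentiableAt_abel)
open Summit.QuantumFields.BalabanUV.Beta.EriceFlowEnclosureB12AsPrintedHistoryContagionShiftFlowZeroSemigroupGellMannLowOneLoop (dynAbel_chart_bounds
  ae_hasDerivAt_dynAbel_oneLoop kappa_mul_le_third)
open Summit.QuantumFields.BalabanUV.Beta.EriceFlowEnclosureB12AsPrintedHistoryContagionShiftFlowZeroSemigroupGellMannLowIntegral (abel_absolutelyContinuousOnInterval)
open Summit.QuantumFields.BalabanUV.Beta.EriceFlowEnclosureB12AsPrintedHistoryContagionShiftFlowZeroSemigroupGellMannLowExact (const_hasDerivAt const_chart_bounds)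

noncomputable section

variable {Λ : ℝ → ℝ} {e' β₀ : ℝ}

/-! ## §103 The a.e. generator is measurable, is a complete invariant of the continuous RG, and one-loop rigidity -/

/-- **THE GENERATOR IS A MEASURABLE FUNCTION**: `β_c = β₀∕Λ′` (with `Λ′ := deriv Λ`, defined everywhere, meaningful a.e.) is Borel measurable — for ANY Λ. [folklore] -/
theorem generator_measurable (Λ : ℝ → ℝ) (β₀ : ℝ) : Measurable (fun x : ℝ => β₀ / deriv Λ x) :=
  measurable_const.div (measurable_deriv Λ)

/-- Part 35's lower chart bound alone makes Λ strictly antitone on ]0, e′]. [folklore] -/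
theorem strictAntiOn_of_bounds (hbounds : ∀ e₁ ∈ Ioc (0 : ℝ) e', ∀ e₂ ∈ Ioc (0 : ℝ) e', e₁ ≤ e₂ →
      2 / 3 * (1 / e₁ ^ 2 - 1 / e₂ ^ 2) ≤ Λ e₁ - Λ e₂ ∧ Λ e₁ - Λ e₂ ≤ 4 / 3 * (1 / e₁ ^ 2 - 1 / e₂ ^ 2)) :
    StrictAntiOn Λ (Ioc 0 e') := by
  intro a ha b hb hab
  have h := (hbounds a ha b hb hab.le).1
  have hΔ : 0 < 1 / a ^ 2 - 1 / b ^ 2 := by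
    have := one_div_lt_one_div_of_lt (pow_pos ha.1 2) (pow_lt_pow_left₀ hab ha.1.le two_ne_zero)
    linarith
  linarith

/-- **TWO Λ-COORDINATES WITH ALMOST-EVERYWHERE EQUAL DERIVATIVES DIFFER BY A CONSTANT**: Λ₁, Λ₂ with part 35's chart bounds on ]0, e′] and `deriv Λ₁ = deriv Λ₂` at a.e.
coupling of ]0, e′[.  THEN `Λ₁ x − Λ₂ x = Λ₁ e′ − Λ₂ e′` on ]0, e′] — both are absolutely continuous on every `[x, e′]` (part 59), their difference has derivative 0 a.e.
[folklore] -/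
theorem abel_sub_eq_of_deriv_ae_eq {Λ₁ Λ₂ : ℝ → ℝ} {e' : ℝ}
    (hb₁ : ∀ e₁ ∈ Ioc (0 : ℝ) e', ∀ e₂ ∈ Ioc (0 : ℝ) e', e₁ ≤ e₂ →
      2 / 3 * (1 / e₁ ^ 2 - 1 / e₂ ^ 2) ≤ Λ₁ e₁ - Λ₁ e₂ ∧ Λ₁ e₁ - Λ₁ e₂ ≤ 4 / 3 * (1 / e₁ ^ 2 - 1 / e₂ ^ 2))
    (hb₂ : ∀ e₁ ∈ Ioc (0 : ℝ) e', ∀ e₂ ∈ Ioc (0 : ℝ) e', e₁ ≤ e₂ →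
      2 / 3 * (1 / e₁ ^ 2 - 1 / e₂ ^ 2) ≤ Λ₂ e₁ - Λ₂ e₂ ∧ Λ₂ e₁ - Λ₂ e₂ ≤ 4 / 3 * (1 / e₁ ^ 2 - 1 / e₂ ^ 2))
    (hae : ∀ᵐ x, x ∈ Ioo (0 : ℝ) e' → deriv Λ₁ x = deriv Λ₂ x) :
    ∀ x ∈ Ioc (0 : ℝ) e', Λ₁ x - Λ₂ x = Λ₁ e' - Λ₂ e' := by
  intro x hx
  have he' : e' ∈ Ioc (0 : ℝ) e' := ⟨hx.1.trans_le hx.2, le_rfl⟩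
  have hac := (abel_absolutelyContinuousOnInterval hb₁ hx he' hx.2).sub (abel_absolutelyContinuousOnInterval hb₂ hx he' hx.2)
  have hd₁ := ae_differentiableAt_abel (strictAntiOn_of_bounds hb₁)
  have hd₂ := ae_differentiableAt_abel (strictAntiOn_of_bounds hb₂)
  have hne : ∀ᵐ y ∂volume, y ∉ ({e'} : Set ℝ) := measure_eq_zero_iff_ae_notMem.1 Real.volume_singleton
  have h0 : ∀ᵐ y, y ∈ uIcc x e' → HasDerivAt (Λ₁ - Λ₂) 0 y := by
    filter_upwards [hd₁, hd₂, hae, hne] with y h1 h2 h3 h4 hy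
    rw [uIcc_of_le hx.2] at hy
    have hyo : y ∈ Ioo (0 : ℝ) e' := ⟨hx.1.trans_le hy.1, lt_of_le_of_ne hy.2 h4⟩
    have d := (h1 hyo).hasDerivAt.sub (h2 hyo).hasDerivAt
    rw [h3 hyo, sub_self] at d
    exact d
  obtain ⟨C, hC⟩ := hac.const_of_ae_hasDerivAt_zero h0
  have h1 := hC x (by rw [uIcc_of_le hx.2]; exact ⟨le_rfl, hx.2⟩)
  have h2 := hC e' (by rw [uIcc_of_le hx.2]; exact ⟨hx.2, le_rfl⟩)
  simp only [Pi.sub_apply] at h1 h2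
  linarith

/-- **THE ALMOST-EVERYWHERE GENERATOR IS A COMPLETE INVARIANT OF THE CONTINUOUS RENORMALIZATION GROUP**: Λ₁ strictly antitone on ]0, e′] onto `[Λ₁ e′, ∞[`, Λ₁ and Λ₂
with the chart bounds, `deriv Λ₁ = deriv Λ₂` a.e. on ]0, e′[ (equivalently `β₀∕Λ₁′ = β₀∕Λ₂′` a.e.), β₀ ≥ 0.  THEN the two continuous renormalization groups COINCIDE:
`Λ₂⁻¹(Λ₂ g + sβ₀) = Λ₁⁻¹(Λ₁ g + sβ₀)` for every `g ∈ ]0, e′]`, `s ≥ 0`. [folklore] -/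
theorem rg_eq_of_deriv_ae_eq {Λ₁ Λ₂ : ℝ → ℝ} {e' β₀ : ℝ}
    (hanti₁ : StrictAntiOn Λ₁ (Ioc 0 e')) (honto₁ : ∀ y : ℝ, Λ₁ e' ≤ y → ∃ x ∈ Ioc (0 : ℝ) e', Λ₁ x = y) (hβ₀ : 0 ≤ β₀)
    (hb₁ : ∀ e₁ ∈ Ioc (0 : ℝ) e', ∀ e₂ ∈ Ioc (0 : ℝ) e', e₁ ≤ e₂ →
      2 / 3 * (1 / e₁ ^ 2 - 1 / e₂ ^ 2) ≤ Λ₁ e₁ - Λ₁ e₂ ∧ Λ₁ e₁ - Λ₁ e₂ ≤ 4 / 3 * (1 / e₁ ^ 2 - 1 / e₂ ^ 2))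
    (hb₂ : ∀ e₁ ∈ Ioc (0 : ℝ) e', ∀ e₂ ∈ Ioc (0 : ℝ) e', e₁ ≤ e₂ →
      2 / 3 * (1 / e₁ ^ 2 - 1 / e₂ ^ 2) ≤ Λ₂ e₁ - Λ₂ e₂ ∧ Λ₂ e₁ - Λ₂ e₂ ≤ 4 / 3 * (1 / e₁ ^ 2 - 1 / e₂ ^ 2))
    (hae : ∀ᵐ x, x ∈ Ioo (0 : ℝ) e' → deriv Λ₁ x = deriv Λ₂ x) {g s : ℝ} (hg : g ∈ Ioc (0 : ℝ) e') (hs : 0 ≤ s) :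
    invFunOn Λ₂ (Ioc 0 e') (Λ₂ g + s * β₀) = invFunOn Λ₁ (Ioc 0 e') (Λ₁ g + s * β₀) := by
  have hae' : ∀ᵐ x, x ∈ Ioo (0 : ℝ) e' → deriv Λ₂ x = deriv Λ₁ x := by
    filter_upwards [hae] with x hx hxo using (hx hxo).symm
  exact rg_eq_of_sub_eq hanti₁ honto₁ hβ₀ (abel_sub_eq_of_deriv_ae_eq hb₂ hb₁ hae') hg hs

/-- **ONE-LOOP RIGIDITY**: Λ with the chart bounds on ]0, e′] and **`Λ′(x) = −2∕x³` at a.e. coupling of ]0, e′[** (the generator IS the one-loop field a.e.).  THEN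
**`Λ g − Λ e′ = 1∕g² − 1∕e′²`** exactly on ]0, e′] — Λ is the toy coordinate of part 52 up to its constant. [folklore] -/
theorem oneLoop_rigidity (hbounds : ∀ e₁ ∈ Ioc (0 : ℝ) e', ∀ e₂ ∈ Ioc (0 : ℝ) e', e₁ ≤ e₂ →
      2 / 3 * (1 / e₁ ^ 2 - 1 / e₂ ^ 2) ≤ Λ e₁ - Λ e₂ ∧ Λ e₁ - Λ e₂ ≤ 4 / 3 * (1 / e₁ ^ 2 - 1 / e₂ ^ 2))
    (hae : ∀ᵐ x, x ∈ Ioo (0 : ℝ) e' → deriv Λ x = -2 / x ^ 3) {g : ℝ} (hg : g ∈ Ioc (0 : ℝ) e') :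
    Λ g - Λ e' = 1 / g ^ 2 - 1 / e' ^ 2 := by
  have hae' : ∀ᵐ x, x ∈ Ioo (0 : ℝ) e' → deriv Λ x = deriv (fun y : ℝ => 1 / y ^ 2 - 1 / e' ^ 2) x := by
    filter_upwards [hae] with x hx hxo
    rw [hx hxo, (const_hasDerivAt (e' := e') hxo.1.ne').deriv]
  have h := abel_sub_eq_of_deriv_ae_eq hbounds const_chart_bounds hae' g hg
  have : (1 : ℝ) / e' ^ 2 - 1 / e' ^ 2 = 0 := sub_self _
  linarith

/-- **… SO THE CONTINUOUS RG IS EXACTLY THE TEXTBOOK ONE-LOOP RUNNING COUPLING**: under `oneLoop_rigidity`'s hypotheses (Λ strictly antitone onto `[Λ e′, ∞[`), β₀ ≥ 0: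
**`φ_s g = 1∕√(1∕g² + sβ₀)`** for every `g ∈ ]0, e′]`, `s ≥ 0`. [folklore] -/
theorem rg_eq_oneLoop_closedForm (hanti : StrictAntiOn Λ (Ioc 0 e')) (honto : ∀ y : ℝ, Λ e' ≤ y → ∃ x ∈ Ioc (0 : ℝ) e', Λ x = y) (hβ₀ : 0 ≤ β₀)
    (hbounds : ∀ e₁ ∈ Ioc (0 : ℝ) e', ∀ e₂ ∈ Ioc (0 : ℝ) e', e₁ ≤ e₂ →
      2 / 3 * (1 / e₁ ^ 2 - 1 / e₂ ^ 2) ≤ Λ e₁ - Λ e₂ ∧ Λ e₁ - Λ e₂ ≤ 4 / 3 * (1 / e₁ ^ 2 - 1 / e₂ ^ 2))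
    (hae : ∀ᵐ x, x ∈ Ioo (0 : ℝ) e' → deriv Λ x = -2 / x ^ 3) {g s : ℝ} (hg : g ∈ Ioc (0 : ℝ) e') (hs : 0 ≤ s) :
    invFunOn Λ (Ioc 0 e') (Λ g + s * β₀) = 1 / Real.sqrt (1 / g ^ 2 + s * β₀) := by
  have hae' : ∀ᵐ x, x ∈ Ioo (0 : ℝ) e' → deriv Λ x = deriv (fun y : ℝ => 1 / y ^ 2 - 1 / e' ^ 2) x := by
    filter_upwards [hae] with x hx hxo
    rw [hx hxo, (const_hasDerivAt (e' := e') hxo.1.ne').deriv]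
  have hsβ : 0 ≤ s * β₀ := mul_nonneg hs hβ₀
  -- same group as the toy's (complete invariant), and the toy's time map is explicit (part 52) at time `sβ₀` with unit rate
  have h1 := rg_eq_of_deriv_ae_eq (β₀ := β₀) hanti honto hβ₀ hbounds const_chart_bounds hae' hg hs
  have h2 := const_rg_eq (e' := e') hg hsβ
  rw [← h1]
  rw [show (1 / g ^ 2 - 1 / e' ^ 2) + s * β₀ = (1 / g ^ 2 - 1 / e' ^ 2) + (s * β₀) * 1 by ring]
  exact h2

/-- **AN A.E.-ONE-LOOP GENERATOR FORCES A TRIVIAL FUNCTIONAL ON THE FLOW'S OWN HISTORIES.**  `B` with memory profile `(C_m, θ)` and value-at-zero letter β₀ ≥ 0; ONE AF reference;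
part 14's package at e′; Λ a dynamical Abel function, strictly antitone on ]0, e′] onto `[Λ e′, ∞[`, with `Λ′(x) = −2∕x³` a.e. on ]0, e′[.  THEN along every box solution h from
every pin `e ∈ ]0, e′]`: **`1∕h(k)² = 1∕e² + kβ₀`** and **`B(h(k+1), h(k+2), …) = β₀`** for every k — the memory functional is the constant β₀ on every ultraviolet tail of
every trajectory near the zero pin. [cite: Balaban1987RG1, Thm 2 (0.31) p.259 with (0.18)–(0.20) pp.255–256] -/
theorem functional_const_of_oneLoop_generator {B : (ℕ → ℝ) → ℝ} {Cm θ γ β₀ bs ta gs e' e : ℝ} {t h : ℕ → ℝ} {a : ℕ → ℝ} {Λ : ℝ → ℝ}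
    (hB : MemoryProfile Cm θ γ B) (hCm : 0 ≤ Cm) (hθ0 : 0 ≤ θ) (hθ1 : θ < 1) (hbs : 0 < bs) (hta : 0 < ta)
    (h0 : ∀ u : ℕ → ℝ, SeqBox γ u → |B u - β₀| ≤ Cm * ∑' j, θ ^ j * u j)
    (hts : SeqBox γ t) (htf : MemFlow B gs t) (hprof : ∀ m : ℕ, 1 / ta ^ 2 + bs * (m : ℝ) ≤ 1 / (t m) ^ 2)
    (hΛ : ∀ e ∈ Ioc (0 : ℝ) e', ∀ h : ℕ → ℝ, SeqBox γ h → MemFlow B e h → Tendsto (fun n => 1 / h n ^ 2 - a n) atTop (𝓝 (Λ e)))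
    (hanti : StrictAntiOn Λ (Ioc 0 e')) (honto : ∀ y : ℝ, Λ e' ≤ y → ∃ x ∈ Ioc (0 : ℝ) e', Λ x = y) (hβ₀ : 0 ≤ β₀)
    (h2e' : 2 * e' ≤ γ)
    (hs1 : 4 * Cm * e' ≤ bs * (1 - θ))
    (hs2 : e' ^ 2 * (1 / gs ^ 2 + Cm * γ / (1 - θ) ^ 2 + (2 * Cm / ((1 - θ) * bs)) ^ 2) ≤ 3 / 4)
    (hs4 : 64 * Cm * e' ^ 3 ≤ (1 - θ) ^ 2) (hs5 : Cm * (8 * e' ^ 3 + 16 * e' / bs) ≤ (1 - θ) / 4)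
    (hae : ∀ᵐ x, x ∈ Ioo (0 : ℝ) e' → deriv Λ x = -2 / x ^ 3)
    (he : e ∈ Ioc (0 : ℝ) e') (hhs : SeqBox γ h) (hhf : MemFlow B e h) (k : ℕ) :
    1 / h k ^ 2 = 1 / e ^ 2 + (k : ℝ) * β₀ ∧ B (fun j => h (k + 1 + j)) = β₀ := by
  have hγ : 0 ≤ γ := by linarith [he.1, he.2]
  have hbounds := dynAbel_chart_bounds hB hCm hθ0 hθ1 hbs hta hts htf hprof hΛ h2e' hs1 hs2 hs4 hs5
  obtain ⟨p1, p2, -, -⟩ := package_of_le hCm hθ1 hbs hγ he.1 he.2 hs1 hs2 hs4 hs5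
  have habel : ∀ k : ℕ, Λ (h k) = Λ e + (k : ℝ) * β₀ := fun k =>
    dynAbel_shift hB hCm hθ0 hθ1 hbs hta h0 hts htf hprof hΛ he hhs hhf p1 p2 k
  have hkmem : ∀ k, h k ∈ Ioc (0 : ℝ) e' := fun k =>
    ⟨(hhs k).1, (succ_le_of_reference_flow hB hCm hθ0 hθ1 hbs hta h0 hts htf hprof hhs hhf p1 p2 k).2.2.trans he.2⟩
  -- the trajectory is the integer-time orbit, and the orbit is one-loop in closed form
  have hchart : ∀ k : ℕ, 1 / h k ^ 2 = 1 / e ^ 2 + (k : ℝ) * β₀ := by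
    intro k
    have horb : invFunOn Λ (Ioc 0 e') (Λ e + (k : ℝ) * β₀) = h k := rg_natCast_eq hanti honto hβ₀ he hkmem habel k
    have hcl := rg_eq_oneLoop_closedForm hanti honto hβ₀ hbounds hae he (Nat.cast_nonneg k)
    rw [horb] at hcl
    have hS : 0 < 1 / e ^ 2 + (k : ℝ) * β₀ := by have := he.1; positivity
    rw [hcl, one_div_sq_one_div_sqrt hS]
  refine ⟨hchart k, ?_⟩
  have hstep := hhf.2 k
  rw [hchart (k + 1), hchart k] at hstep
  push_cast at hstep
  linarith

/-! ## §104 For the flow: the a.e. envelope of the generator -/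

/-- **THE GENERATOR IS SQUEEZED BETWEEN TWO ONE-LOOP ENVELOPES, ALMOST EVERYWHERE**: for every dynamical Abel function of the flow near the zero pin (β₀ > 0), for a.e.
`x ∈ ]0, e′[`: **`−(β₀∕2)x³∕(1 − κx) ≤ β₀∕Λ′(x) ≤ −(β₀∕2)x³∕(1 + κx)`**, `κ = 64C_m∕(3(1−θ)β*)`, `κx ≤ 1∕3` — β_c is an `L^∞_loc` function with the one-loop shape.
[cite: Balaban1987RG1, Thm 2 (0.31) p.259 with (0.18)–(0.20) pp.255–256] -/
theorem generator_ae_envelope {B : (ℕ → ℝ) → ℝ} {Cm θ γ β₀ bs ta gs e' : ℝ} {t : ℕ → ℝ} {a : ℕ → ℝ} {Λ : ℝ → ℝ}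
    (hB : MemoryProfile Cm θ γ B) (hCm : 0 ≤ Cm) (hθ0 : 0 ≤ θ) (hθ1 : θ < 1) (hbs : 0 < bs) (hta : 0 < ta)
    (hts : SeqBox γ t) (htf : MemFlow B gs t) (hprof : ∀ m : ℕ, 1 / ta ^ 2 + bs * (m : ℝ) ≤ 1 / (t m) ^ 2)
    (hΛ : ∀ e ∈ Ioc (0 : ℝ) e', ∀ h : ℕ → ℝ, SeqBox γ h → MemFlow B e h → Tendsto (fun n => 1 / h n ^ 2 - a n) atTop (𝓝 (Λ e)))
    (hanti : StrictAntiOn Λ (Ioc 0 e')) (hβ₀ : 0 < β₀)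
    (h2e' : 2 * e' ≤ γ)
    (hs1 : 4 * Cm * e' ≤ bs * (1 - θ))
    (hs2 : e' ^ 2 * (1 / gs ^ 2 + Cm * γ / (1 - θ) ^ 2 + (2 * Cm / ((1 - θ) * bs)) ^ 2) ≤ 3 / 4)
    (hs4 : 64 * Cm * e' ^ 3 ≤ (1 - θ) ^ 2) (hs5 : Cm * (8 * e' ^ 3 + 16 * e' / bs) ≤ (1 - θ) / 4) :
    ∀ᵐ x, x ∈ Ioo (0 : ℝ) e' →
      -(β₀ / 2) * x ^ 3 / (1 - 64 * Cm / (3 * (1 - θ) * bs) * x) ≤ β₀ / deriv Λ x ∧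
        β₀ / deriv Λ x ≤ -(β₀ / 2) * x ^ 3 / (1 + 64 * Cm / (3 * (1 - θ) * bs) * x) := by
  set κ := 64 * Cm / (3 * (1 - θ) * bs) with hκdef
  have h1θ : 0 < 1 - θ := by linarith
  have hκ0 : 0 ≤ κ := by positivity
  filter_upwards [ae_hasDerivAt_dynAbel_oneLoop hB hCm hθ0 hθ1 hbs hta hts htf hprof hΛ hanti h2e' hs1 hs2 hs4 hs5] with x hx hxo
  obtain ⟨D, hD, hb⟩ := hx hxo
  rw [hD.deriv]
  have hκx : κ * x ≤ 1 / 3 :=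
    (mul_le_mul_of_nonneg_left hxo.2.le hκ0).trans (kappa_mul_le_third hCm hθ1 hbs (hxo.1.trans hxo.2).le hs5)
  have hx3 : 0 < x ^ 3 := pow_pos hxo.1 3
  have hm : 0 < 1 - κ * x := by linarith
  have hp : 0 < 1 + κ * x := by have := mul_nonneg hκ0 hxo.1.le; linarith
  -- `u := (−x³∕2)·D ∈ [1 − κx, 1 + κx]`, `u > 0`, and `β₀∕D = −(β₀x³∕2)∕u`
  set u := -(x ^ 3) / 2 * D with hudef
  obtain ⟨hlo, hhi⟩ := abs_le.1 hb
  have hu1 : 1 - κ * x ≤ u := by linarith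
  have hu2 : u ≤ 1 + κ * x := by linarith
  have hu0 : 0 < u := lt_of_lt_of_le hm hu1
  have hDu : D = -2 * u / x ^ 3 := by
    rw [hudef, show -2 * (-(x ^ 3) / 2 * D) = D * x ^ 3 by ring, mul_div_assoc, div_self hx3.ne', mul_one]
  have hDne : D ≠ 0 := by rw [hDu]; exact div_ne_zero (by linarith) hx3.ne'
  have hquot : β₀ / D = -(β₀ * x ^ 3 / 2 / u) := by rw [hDu]; field_simp
  rw [hquot]
  have hc : 0 ≤ β₀ * x ^ 3 / 2 := by positivity
  constructor
  · -- `β₀x³∕2∕u ≤ β₀x³∕2∕(1 − κx)`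
    have := div_le_div_of_nonneg_left hc hm hu1
    have e1 : -(β₀ / 2) * x ^ 3 / (1 - κ * x) = -(β₀ * x ^ 3 / 2 / (1 - κ * x)) := by ring
    rw [e1]; linarith
  · have := div_le_div_of_nonneg_left hc hu0 hu2
    have e1 : -(β₀ / 2) * x ^ 3 / (1 + κ * x) = -(β₀ * x ^ 3 / 2 / (1 + κ * x)) := by ring
    rw [e1]; linarith

end

end Summit.QuantumFields.BalabanUV.Beta.EriceFlowEnclosureB12AsPrintedHistoryContagionShiftFlowZeroSemigroupGenerator
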